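import Literature.Analysis.OperatorTheory.Enflo2023.StepRealisationOrbit
import Literature.Analysis.OperatorTheory.Enflo2023.StepRealisationDiag
import HarnessLib

/-!
# Enflo (2023), Part B — the orbit residual fails in EVERY finite dimension: diagonal operators with simple
spectrum on `ℂ^d`, from every cyclic start (`StepRealisation.DiagN`)

WHAT THIS FILE DECIDES.  `StepRealisationDiag` refuted the run-level independence hypothesis `IndepRunκ` (and
`StepRealisationOrbitModels` its orbit form `IndepRunD`) for ONE operator, `T_τ = τ·diag(1, ½)` on `ℂ²`, by a
`2 × 2` Cayley–Hamilton identity.  Here the dimension, the spectrum and the start are arbitrary: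

* `DiagN.indepRunD_etheta_eq_zero` — for every `d`, every real diagonal operator `T_w = diag(w₀, …, w_{d−1})` on
  `ℂ^d` with DISTINCT weights `|w_i| ≤ τ ≤ σ/100`, every unit `x₀`, `0 < σ ≤ 1`, `0 < β ≤ σ²/1000`, and every
  admissible start `s₀` (true MC state of an intertwiner `V`, `V S = T_w V`, with the run's start margin) whose
  vector `y₀ = V e₀` has ALL coordinates non-zero:  `IndepRunD T_w x₀ S (ιS S) σ β s₀ → (εθ)₀ = 0`.
  (`DiagN.indepRunκ_etheta_eq_zero`: the same for `IndepRunκ`.)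
* `DiagN.not_indepRunD_two` — the hypotheses are met non-vacuously: for `d = 2`, `w = (τ, τ/2)` the operator is
  `Diag.TD τ` (`DiagN.TDg_wt`) and `Diag.exists_start_at` supplies admissible starts with `(εθ)₀ > 0` and both
  coordinates of `y₀` non-zero; the general theorem re-proves `Diag.not_indepRunD` there.

For a diagonal operator with distinct eigenvalues the vectors with all coordinates non-zero are exactly the cyclic
ones (Vandermonde; the record proves the `d = 2` case, `Diag.cyclic_of_ne`), so in words: FOR EVERY SUCH OPERATOR
(any `d`, any simple real spectrum in `[−σ/100, σ/100]`) THE INTRINSIC INDEPENDENCE (34), DEMANDED ALONG THE ORBIT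
THE CONSTRUCTION (35)–(46) GENERATES, FAILS FROM EVERY CYCLIC START — the only starts the theorem does not exclude
are vectors `y₀` with a vanishing eigen-coordinate, i.e. vectors that are ALREADY non-cyclic (where the Main
Construction has nothing left to do).

THE MECHANISM (replacing Cayley–Hamilton).  Write `V†u_i = c_i·g_{w_i}` (`DiagN.adjoint_u`; `g_μ = (μʲ)_j ∈ ℓ²`,
`c_i = conj (y₀)_i`, `DiagN.cf_eq`).  (a) UPPER FRAME BOUND: `‖Vb‖² ≤ (4/3)(Σ|c_i|²)‖b‖²` (`DiagN.norm_apply_sq_le`,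
from `|(Vb)_i| = |c_i||⟪g_i, b⟫|`, `‖g_i‖² ≤ 4/3`).  (b) LOWER FRAME BOUND: the `g_{w_i}` are linearly independent
(a `d × d` Vandermonde determinant, `DiagN.syn_injective`), so by finite-dimensionality there is `γ = γ(w) > 0` with
`‖Σ a_i g_{w_i}‖² ≥ γ·Σ|a_i|²` (`DiagN.exists_frame`, Mathlib's `LinearMap.injective_iff_antilipschitz`).  (c) THE
STATE BOUND (`DiagN.state_bound`, `DiagN.phi_le`): at a bracket point `z + VV†z = x₀` with `‖z‖, ‖x₀ − z‖ ≥ 0.3`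
and `(εθ) = ‖V†z‖²`, (a) gives `Σ|c_i|² ≥ 0.0675/(εθ)` (the top of `K = VV†` is `≥ 0.09/(εθ)`) and (b) gives an
index `i` with `0.09·γ·|c_i|² ≤ (εθ)` (the bottom of `K` on the support of `z` is `≤ (εθ)/0.09`); hence the
scale-free weight `Φ_i := |c_i|²/Σ_j|c_j|²` of SOME eigen-coordinate is `≤ (εθ)²/(0.006075·γ)`.  (d) THE STEP
(`DiagN.phi_step`): an admissible step `V ↦ r·V(1 + N)`, `N ∈ {S}'`, `‖N‖ ≤ ν = 2β/σ ≤ ½`, multiplies `c_i` by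
`1 + n_{w_i}` (`DiagN.cf_comp`, `Diag.adjoint_gv_of_comm`) with `|n_{w_i} − n_{w_j}| ≤ 2‖N‖·‖g_{w_i} − g_{w_j}‖ ≤ 8ντ`
(`Diag.norm_ev_sub_le`, `DiagN.norm_gv_sub_le`: `‖g_μ − g_ν‖ ≤ 2|μ − ν|` on `[−½, ½]`), so EVERY weight `Φ_i` drops
per step at most by the factor `(1 + 16ντ)²` (`Diag.mult_ratio`) and no coordinate dies.  (e) THE RUN: along the
orbit `(εθ)_n = (1−β)ⁿ(εθ)₀` exactly, so (c) and (d) give `0.006075·γ·min_iΦ_i(s₀) ≤ ((1−β)²(1+16ντ)²)ⁿ(εθ)₀² → 0`,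
because `(1−β)(1 + 32βτ/σ) < 1` for `τ ≤ σ/100` — absurd when every `Φ_i(s₀) > 0`.  In words: (16) forces the
coefficient vector `(c_i)` to CONCENTRATE AWAY from some eigen-coordinate at the geometric rate `(1−β)^{n}`, while a
commutant element of norm `2β/σ` re-weights eigen-coordinates at distance `≤ 2τ` by factors differing by `≤ 32βτ/σ`:
for `‖T‖ ≪ σ` the dynamics (35)/(45) cannot produce the degeneration that (16) demands.

SCOPE.  As in `StepRealisationDiag`: the closure uses `τ ≤ σ/100` (`τ < σ/32` would do); for a modulus `σ` below
`32‖T‖` nothing is claimed; starts with a vanishing eigen-coordinate of `y₀` (non-cyclic `y₀`) are not treated (for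
`d = 2` they fail at the first pivot, `Diag.not_indepBrκ_of_degenerate`; for `d ≥ 3` the record decides nothing about
them).  The theorem decides nothing about operators on infinite-dimensional `H` without invariant subspaces — the
class the disputed residual `PartBResidualIndepD` quantifies over — where no `γ(w) > 0` exists.

STATUS for the repair record: a CALIBRATION of the located gap (v2 p.16 (34) with one modulus along the run;
p.19 l.656–677), not a claim about the text's setting.  No new axioms; zero `sorry`; every `ℓ²`/commutant lemma of
`StepRealisationDiag` §A, §E is reused by name, not restated.
-/

noncomputable section

open scoped InnerProductSpace ComplexConjugate ENNReal
open ContinuousLinearMap Filter Topology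

namespace Literature.Analysis.OperatorTheory.Enflo2023

namespace StepRealisation

open MCStep Vy
open Lemma1.Standing (e e_apply norm_e inner_e_left)

namespace DiagN

variable {d : ℕ}

/-- `ℂ^d` as a Hilbert space (the model's `H`). [folklore] -/
abbrev Cd (d : ℕ) : Type := EuclideanSpace ℂ (Fin d)

/-! ### A. Coordinates on `ℂ^d` -/

/-- the standard unit vectors `u_i` of `ℂ^d`. [folklore] -/
def u (i : Fin d) : Cd d := EuclideanSpace.single i (1 : ℂ)

/-- `⟪u_i, v⟫ = v_i`. [folklore] -/
@[simp] lemma inner_u_left (i : Fin d) (v : Cd d) : ⟪u i, v⟫_ℂ = v i := by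
  simp [u, EuclideanSpace.inner_single_left]

/-- `⟪v, u_i⟫ = conj v_i`. [folklore] -/
@[simp] lemma inner_u_right (i : Fin d) (v : Cd d) : ⟪v, u i⟫_ℂ = conj (v i) := by
  simp [u, EuclideanSpace.inner_single_right]

/-- `(u_i)_j = [j = i]`. [folklore] -/
lemma u_apply (i j : Fin d) : u i j = if j = i then 1 else 0 := by
  rw [u]
  exact PiLp.single_apply _ _ i 1 j

/-- coordinates of a combination of the `u_i`. [folklore] -/
lemma sum_smul_u_apply (f : Fin d → ℂ) (j : Fin d) : (∑ i, f i • u i : Cd d) j = f j := by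
  rw [← inner_u_left, inner_sum]
  simp_rw [inner_smul_right, inner_u_left, u_apply, mul_ite, mul_one, mul_zero]
  rw [Finset.sum_ite_eq]
  simp

/-- expansion in coordinates. [folklore] -/
lemma decomp_u (x : Cd d) : x = ∑ i, x i • u i := by
  ext j
  rw [sum_smul_u_apply]

/-- `‖Σ f_i u_i‖² = Σ |f_i|²`. [folklore] -/
lemma norm_sq_sum_smul_u (f : Fin d → ℂ) : ‖(∑ i, f i • u i : Cd d)‖ ^ 2 = ∑ i, ‖f i‖ ^ 2 := by
  rw [EuclideanSpace.norm_sq_eq]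
  simp_rw [sum_smul_u_apply]

/-! ### B. The model operators `T_w = diag(w)` on `ℂ^d` -/

/-- THE MODEL OPERATORS `T_w = diag(w₀, …, w_{d−1})` on `ℂ^d` (real weights; for distinct weights the cyclic vectors
are those with all coordinates non-zero). [cite: Enflo2023, v2 p.6 (19), p.7 (type 1)] -/
def TDg (w : Fin d → ℝ) : Cd d →L[ℂ] Cd d :=
  ∑ i, ((w i : ℝ) : ℂ) • (EuclideanSpace.proj i : Cd d →L[ℂ] ℂ).smulRight (u i)

/-- `T_w v = Σ (w_i v_i) u_i`. [folklore] -/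
lemma TDg_apply_eq (w : Fin d → ℝ) (v : Cd d) : TDg w v = ∑ i, (((w i : ℝ) : ℂ) * v i) • u i := by
  simp only [TDg, _root_.sum_apply, _root_.smul_apply, ContinuousLinearMap.smulRight_apply, smul_smul]
  rfl

/-- `(T_w v)_j = w_j v_j`. [folklore] -/
@[simp] lemma TDg_apply (w : Fin d → ℝ) (v : Cd d) (j : Fin d) : (TDg w v) j = ((w j : ℝ) : ℂ) * v j := by
  rw [TDg_apply_eq, sum_smul_u_apply]

/-- consistency with the `d = 2` model: `T_{(τ, τ/2)} = Diag.TD τ`. [folklore] -/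
theorem TDg_wt (τ : ℝ) : TDg (Diag.wt τ) = Diag.TD τ := by
  ext v j
  rw [TDg_apply, Diag.TD_apply]

/-! ### C. Intertwiners `V S = T_w V`: `V†u_i = c_i·g_{w_i}` -/

section intertwiner

variable {w : Fin d → ℝ} {V : ℓ2 →L[ℂ] Cd d}

/-- THE EIGEN-COEFFICIENTS `c_i := (V†u_i)₀` of an intertwiner. [folklore] -/
def cf (V : ℓ2 →L[ℂ] Cd d) (i : Fin d) : ℂ := adjoint V (u i) 0

/-- coordinates of `V†x`: `(V†x)_k = ⟪V e_k, x⟫`. [folklore] -/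
lemma adjoint_apply_coord (V : ℓ2 →L[ℂ] Cd d) (x : Cd d) (k : ℕ) : adjoint V x k = ⟪V (e k), x⟫_ℂ := by
  rw [← inner_e_left, adjoint_inner_right]

/-- `c_i = conj (V e₀)_i`: the eigen-coefficients are the conjugated coordinates of `y₀ = V e₀`. [cite: Enflo2023, v2 (2)–(4) p.2] -/
lemma cf_eq (V : ℓ2 →L[ℂ] Cd d) (i : Fin d) : cf V i = conj (V (e 0) i) := by
  rw [cf, adjoint_apply_coord, inner_u_right]

/-- the recursion `(V†u_i)_{k+1} = w_i (V†u_i)_k` forced by `V S = T_w V`. [cite: Enflo2023, v2 (2)–(4) p.2] -/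
lemma adjoint_u_succ (hVS : ∀ b, V (S b) = TDg w (V b)) (i : Fin d) (k : ℕ) :
    adjoint V (u i) (k + 1) = ((w i : ℝ) : ℂ) * adjoint V (u i) k := by
  rw [adjoint_apply_coord, adjoint_apply_coord, ← Diag.S_e, hVS, inner_u_right, inner_u_right, TDg_apply,
    map_mul, Complex.conj_ofReal]

/-- STRUCTURE OF THE INTERTWINERS: `V†u_i = c_i·g_{w_i}`. [cite: Enflo2023, v2 (2)–(4) p.2] -/
lemma adjoint_u (hw : ∀ i, |w i| < 1) (hVS : ∀ b, V (S b) = TDg w (V b)) (i : Fin d) :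
    adjoint V (u i) = cf V i • Diag.gv (w i) := by
  apply lp.ext
  funext k
  rw [lp.coeFn_smul, Pi.smul_apply, smul_eq_mul, Diag.gv_apply (hw i)]
  induction k with
  | zero => rw [pow_zero, mul_one]; rfl
  | succ k ih => rw [adjoint_u_succ hVS, ih, pow_succ]; ring

/-- `V†x = Σ (x_i c_i)·g_{w_i}`. [cite: Enflo2023, v2 (4) p.2] -/
lemma adjoint_eq (hw : ∀ i, |w i| < 1) (hVS : ∀ b, V (S b) = TDg w (V b)) (x : Cd d) :
    adjoint V x = ∑ i, (x i * cf V i) • Diag.gv (w i) := by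
  conv_lhs => rw [decomp_u x]
  rw [map_sum]
  refine Finset.sum_congr rfl (fun i _ => ?_)
  rw [map_smul, adjoint_u hw hVS i, smul_smul]

/-- `(V b)_i = conj(c_i)·⟪g_{w_i}, b⟫`. [cite: Enflo2023, v2 (2) p.2] -/
lemma apply_coord (hw : ∀ i, |w i| < 1) (hVS : ∀ b, V (S b) = TDg w (V b)) (b : ℓ2) (i : Fin d) :
    V b i = conj (cf V i) * ⟪Diag.gv (w i), b⟫_ℂ := by
  rw [← inner_u_left, ← adjoint_inner_left, adjoint_u hw hVS i, inner_smul_left]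

/-- UPPER FRAME BOUND: `‖V b‖² ≤ (4/3)(Σ|c_i|²)‖b‖²` (all `‖g_{w_i}‖² ≤ 4/3`). [folklore] -/
lemma norm_apply_sq_le (hw : ∀ i, |w i| < 1) (hg : ∀ i, ‖Diag.gv (w i)‖ ^ 2 ≤ 4 / 3)
    (hVS : ∀ b, V (S b) = TDg w (V b)) (b : ℓ2) :
    ‖V b‖ ^ 2 ≤ 4 / 3 * (∑ i, ‖cf V i‖ ^ 2) * ‖b‖ ^ 2 := by
  rw [EuclideanSpace.norm_sq_eq]
  have hterm : ∀ i, ‖V b i‖ ^ 2 ≤ ‖cf V i‖ ^ 2 * (4 / 3 * ‖b‖ ^ 2) := by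
    intro i
    rw [apply_coord hw hVS, norm_mul, mul_pow, RCLike.norm_conj]
    refine mul_le_mul_of_nonneg_left ?_ (sq_nonneg _)
    calc ‖⟪Diag.gv (w i), b⟫_ℂ‖ ^ 2 ≤ (‖Diag.gv (w i)‖ * ‖b‖) ^ 2 :=
          pow_le_pow_left₀ (norm_nonneg _) (norm_inner_le_norm _ _) 2
      _ = ‖Diag.gv (w i)‖ ^ 2 * ‖b‖ ^ 2 := mul_pow _ _ 2
      _ ≤ 4 / 3 * ‖b‖ ^ 2 := mul_le_mul_of_nonneg_right (hg i) (sq_nonneg _)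
  calc ∑ i, ‖V b i‖ ^ 2 ≤ ∑ i, ‖cf V i‖ ^ 2 * (4 / 3 * ‖b‖ ^ 2) := Finset.sum_le_sum (fun i _ => hterm i)
    _ = 4 / 3 * (∑ i, ‖cf V i‖ ^ 2) * ‖b‖ ^ 2 := by rw [← Finset.sum_mul]; ring

/-- ONE COMMUTANT STEP ON THE COEFFICIENTS: `c_i(V(1 + N)) = c_i(V)·(1 + n_{w_i})`. [cite: Enflo2023, v2 (35)–(38) p.16–17] -/
lemma cf_comp (hw : ∀ i, |w i| < 1) (hVS : ∀ b, V (S b) = TDg w (V b)) (N : ℓ2 →L[ℂ] ℓ2) (i : Fin d) :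
    cf (V ∘L (1 + N)) i = cf V i * (1 + Diag.ev N (w i)) := by
  have a := hw i
  rw [cf, adjoint_apply_coord, comp_apply, ← adjoint_inner_right, adjoint_u hw hVS i, inner_smul_right,
    add_apply, one_apply_eq_self, inner_add_left, inner_e_left, Diag.gv_zero a, ← adjoint_inner_right,
    inner_e_left]
  rfl

/-- scaling: `c_i(r·V) = conj r · c_i(V)`. [folklore] -/
lemma cf_smul (r : ℂ) (V : ℓ2 →L[ℂ] Cd d) (i : Fin d) : cf (r • V) i = conj r * cf V i := by
  rw [cf, cf, adjoint_apply_coord, adjoint_apply_coord, smul_apply, inner_smul_left]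

end intertwiner

/-! ### D. Frame bounds for the geometric vectors `g_{w_i}` -/

section frame

variable {w : Fin d → ℝ}

/-- `‖g_μ‖² ≤ 4/3` for `|μ| ≤ ½`. [folklore] -/
lemma norm_gv_sq_le {μ : ℝ} (h : |μ| ≤ 1 / 2) : ‖Diag.gv μ‖ ^ 2 ≤ 4 / 3 := by
  have h1 : |μ| < 1 := by linarith
  have hμ : μ * μ ≤ 1 / 4 := by
    have := abs_le.1 h
    nlinarith
  rw [Diag.norm_gv_sq h1]
  calc (1 - μ * μ)⁻¹ ≤ (3 / 4 : ℝ)⁻¹ := inv_anti₀ (by norm_num) (by linarith)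
    _ = 4 / 3 := by norm_num

/-- `‖g_μ − g_ν‖ ≤ 2|μ − ν|` for `|μ|, |ν| ≤ ½`
(`‖g_μ − g_ν‖² = (μ−ν)²(1+μν)/((1−μ²)(1−μν)(1−ν²))`). [folklore] -/
lemma norm_gv_sub_le {μ ν : ℝ} (hμ : |μ| ≤ 1 / 2) (hν : |ν| ≤ 1 / 2) :
    ‖Diag.gv μ - Diag.gv ν‖ ≤ 2 * |μ - ν| := by
  have hμ1 : |μ| < 1 := by linarith
  have hν1 : |ν| < 1 := by linarith
  have aμ := abs_le.1 hμ
  have aν := abs_le.1 hν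
  have hA : 3 / 4 ≤ 1 - μ * μ := by nlinarith
  have hB : 3 / 4 ≤ 1 - μ * ν := by nlinarith
  have hC : 3 / 4 ≤ 1 - ν * ν := by nlinarith
  have h5 : 1 + μ * ν ≤ 5 / 4 := by nlinarith
  have hA0 : 1 - μ * μ ≠ 0 := by linarith
  have hB0 : 1 - μ * ν ≠ 0 := by linarith
  have hC0 : 1 - ν * ν ≠ 0 := by linarith
  have hsq : ‖Diag.gv μ - Diag.gv ν‖ ^ 2 = (1 - μ * μ)⁻¹ - 2 * (1 - μ * ν)⁻¹ + (1 - ν * ν)⁻¹ := by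
    rw [norm_sub_sq (𝕜 := ℂ), Diag.norm_gv_sq hμ1, Diag.norm_gv_sq hν1, Diag.inner_gv_gv hμ1 hν1]
    simp only [RCLike.re_to_complex, Complex.ofReal_re]
  have hid : (1 - μ * μ)⁻¹ - 2 * (1 - μ * ν)⁻¹ + (1 - ν * ν)⁻¹ =
      (μ - ν) ^ 2 * (1 + μ * ν) / ((1 - μ * μ) * ((1 - μ * ν) * (1 - ν * ν))) := by
    have hA0' : 1 - μ ^ 2 ≠ 0 := by rw [sq]; exact hA0
    have hC0' : 1 - ν ^ 2 ≠ 0 := by rw [sq]; exact hC0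
    rw [eq_div_iff (mul_ne_zero hA0 (mul_ne_zero hB0 hC0)), inv_eq_one_div, inv_eq_one_div, inv_eq_one_div]
    field_simp
    ring
  have hBC : 9 / 16 ≤ (1 - μ * ν) * (1 - ν * ν) := by nlinarith [mul_le_mul hB hC (by norm_num) (by linarith)]
  have hABC : 27 / 64 ≤ (1 - μ * μ) * ((1 - μ * ν) * (1 - ν * ν)) := by
    nlinarith [mul_le_mul hA hBC (by norm_num) (by linarith)]
  have hle : ‖Diag.gv μ - Diag.gv ν‖ ^ 2 ≤ (2 * |μ - ν|) ^ 2 := by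
    rw [hsq, hid, div_le_iff₀ (by positivity), mul_pow, sq_abs]
    nlinarith [sq_nonneg (μ - ν), mul_le_mul_of_nonneg_left hABC (sq_nonneg (μ - ν)),
      mul_le_mul_of_nonneg_left h5 (sq_nonneg (μ - ν))]
  exact (pow_le_pow_iff_left₀ (norm_nonneg _) (by positivity) two_ne_zero).1 hle

/-- THE SYNTHESIS OPERATOR `a ↦ Σ a_i g_{w_i}` of the frame `(g_{w_i})`. [folklore] -/
def syn (w : Fin d → ℝ) : Cd d →L[ℂ] ℓ2 :=
  ∑ i, (EuclideanSpace.proj i : Cd d →L[ℂ] ℂ).smulRight (Diag.gv (w i))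

/-- `syn a = Σ a_i g_{w_i}`. [folklore] -/
lemma syn_apply (w : Fin d → ℝ) (a : Cd d) : syn w a = ∑ i, a i • Diag.gv (w i) := by
  simp only [syn, _root_.sum_apply, ContinuousLinearMap.smulRight_apply]
  rfl

/-- coordinates: `(Σ a_i g_{w_i})_k = Σ a_i w_iᵏ`. [folklore] -/
lemma sum_smul_gv_apply (hw : ∀ i, |w i| < 1) (a : Fin d → ℂ) (k : ℕ) :
    (∑ i, a i • Diag.gv (w i) : ℓ2) k = ∑ i, a i * ((w i : ℝ) : ℂ) ^ k := by
  rw [← inner_e_left, inner_sum]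
  refine Finset.sum_congr rfl (fun i _ => ?_)
  rw [inner_smul_right, inner_e_left, Diag.gv_apply (hw i)]

/-- LINEAR INDEPENDENCE OF `g_{w_0}, …, g_{w_{d−1}}` for distinct weights (a Vandermonde determinant). [folklore] -/
lemma syn_injective (hw : ∀ i, |w i| < 1) (hinj : Function.Injective w) : Function.Injective (syn w) := by
  refine (injective_iff_map_eq_zero (syn w)).2 (fun a ha => ?_)
  have hdet : (Matrix.vandermonde (fun i => ((w i : ℝ) : ℂ))).det ≠ 0 :=
    Matrix.det_vandermonde_ne_zero_iff.2 (fun i j hij => hinj (by exact_mod_cast hij))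
  have hvec : Matrix.vecMul (WithLp.ofLp a) (Matrix.vandermonde (fun i => ((w i : ℝ) : ℂ))) = 0 := by
    funext k
    have hk := congrArg (fun v : ℓ2 => (v : ℕ → ℂ) k) ha
    simp only [syn_apply, lp.coeFn_zero, Pi.zero_apply] at hk
    rw [sum_smul_gv_apply hw] at hk
    have hv : Matrix.vecMul (WithLp.ofLp a) (Matrix.vandermonde (fun i => ((w i : ℝ) : ℂ))) k =
        ∑ i, a i * ((w i : ℝ) : ℂ) ^ (k : ℕ) := by
      simp only [Matrix.vecMul, dotProduct, Matrix.vandermonde_apply]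
    rw [hv, Pi.zero_apply]
    exact hk
  have h0 := Matrix.eq_zero_of_vecMul_eq_zero hdet hvec
  exact (WithLp.ofLp_eq_zero 2).1 h0

/-- LOWER FRAME BOUND: there is `γ = γ(w) > 0` with `‖Σ a_i g_{w_i}‖² ≥ γ·Σ|a_i|²` (finite-dimensionality).
[folklore] -/
theorem exists_frame (hw : ∀ i, |w i| < 1) (hinj : Function.Injective w) :
    ∃ γ : ℝ, 0 < γ ∧ ∀ a : Fin d → ℂ, γ * ∑ i, ‖a i‖ ^ 2 ≤ ‖(∑ i, a i • Diag.gv (w i) : ℓ2)‖ ^ 2 := by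
  obtain ⟨K, -, hK⟩ :=
    (LinearMap.injective_iff_antilipschitz (syn w : Cd d →ₗ[ℂ] ℓ2)).1 (syn_injective hw hinj)
  obtain ⟨c, hc, hcle⟩ :=
    (antilipschitzWith_iff_exists_mul_le_norm (f := (syn w : Cd d →ₗ[ℂ] ℓ2))).1 ⟨K, hK⟩
  refine ⟨c ^ 2, by positivity, fun a => ?_⟩
  have h1 := hcle (WithLp.toLp 2 a)
  have h2 : ‖(WithLp.toLp 2 a : Cd d)‖ ^ 2 = ∑ i, ‖a i‖ ^ 2 := by
    rw [EuclideanSpace.norm_sq_eq]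
  have h3 : (syn w : Cd d →ₗ[ℂ] ℓ2) (WithLp.toLp 2 a) = ∑ i, a i • Diag.gv (w i) := by
    rw [ContinuousLinearMap.coe_coe, syn_apply]
  rw [h3] at h1
  calc c ^ 2 * ∑ i, ‖a i‖ ^ 2 = (c * ‖(WithLp.toLp 2 a : Cd d)‖) ^ 2 := by rw [mul_pow, h2]
    _ ≤ _ := pow_le_pow_left₀ (by positivity) h1 2

end frame

/-! ### E. The state bound and the scale-free weights `Φ_i = |c_i|²/Σ|c_j|²` -/

section statebound

variable {w : Fin d → ℝ} {W : ℓ2 →L[ℂ] Cd d} {x₀ z : Cd d}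

/-- **THE STATE BOUND.**  At a bracket point `z + WW†z = x₀` of an intertwiner `W` with `‖z‖, ‖x₀ − z‖ ≥ 0.3`
(true at every MC state) and `E := ‖W†z‖² = (εθ)`:  `0.0675 ≤ E·Σ|c_i|²` (upper frame bound: the top of `K`)
and `0.09·γ·|c_i|² ≤ E` for SOME `i` (lower frame bound: the bottom of `K` under `z`).
[cite: Enflo2023, v2 (15)–(16) p.5–6; (32) p.15] -/
theorem state_bound (hw : ∀ i, |w i| < 1) (hg : ∀ i, ‖Diag.gv (w i)‖ ^ 2 ≤ 4 / 3) {γ : ℝ} (hγ0 : 0 < γ)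
    (hγ : ∀ a : Fin d → ℂ, γ * ∑ i, ‖a i‖ ^ 2 ≤ ‖(∑ i, a i • Diag.gv (w i) : ℓ2)‖ ^ 2)
    (hWS : ∀ b, W (S b) = TDg w (W b)) (hz : IsBracket W x₀ z) (hz3 : (0.3 : ℝ) ≤ ‖z‖)
    (hxz : (0.3 : ℝ) ≤ ‖x₀ - z‖) :
    (0.0675 : ℝ) ≤ ‖adjoint W z‖ ^ 2 * ∑ i, ‖cf W i‖ ^ 2 ∧
      ∃ i, 0.09 * γ * ‖cf W i‖ ^ 2 ≤ ‖adjoint W z‖ ^ 2 := by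
  constructor
  · have hz' : z + W (adjoint W z) = x₀ := hz
    have hK : x₀ - z = W (adjoint W z) := by rw [← hz']; abel
    have h1 : (0.09 : ℝ) ≤ ‖x₀ - z‖ ^ 2 := by nlinarith
    have h2 := norm_apply_sq_le hw hg hWS (adjoint W z)
    rw [← hK] at h2
    nlinarith [h2]
  · have hne : (Finset.univ : Finset (Fin d)).Nonempty := by
      by_contra h0
      rw [Finset.not_nonempty_iff_eq_empty] at h0
      have : ‖z‖ ^ 2 = 0 := by rw [EuclideanSpace.norm_sq_eq, h0, Finset.sum_empty]
      nlinarith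
    obtain ⟨i, -, hi⟩ := Finset.exists_min_image Finset.univ (fun i => ‖cf W i‖ ^ 2) hne
    refine ⟨i, ?_⟩
    have hE : ‖adjoint W z‖ ^ 2 = ‖(∑ j, (z j * cf W j) • Diag.gv (w j) : ℓ2)‖ ^ 2 := by
      rw [adjoint_eq hw hWS]
    have h1 := hγ (fun j => z j * cf W j)
    have h2 : ‖cf W i‖ ^ 2 * ∑ j, ‖z j‖ ^ 2 ≤ ∑ j, ‖z j * cf W j‖ ^ 2 := by
      rw [Finset.mul_sum]
      refine Finset.sum_le_sum (fun j _ => ?_)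
      rw [norm_mul, mul_pow]
      have hij : ‖cf W i‖ ^ 2 ≤ ‖cf W j‖ ^ 2 := hi j (Finset.mem_univ j)
      nlinarith [sq_nonneg ‖z j‖]
    have h3 : ∑ j, ‖z j‖ ^ 2 = ‖z‖ ^ 2 := (EuclideanSpace.norm_sq_eq z).symm
    have h4 : (0.09 : ℝ) ≤ ‖z‖ ^ 2 := by nlinarith
    rw [h3] at h2
    have h5 : γ * (‖cf W i‖ ^ 2 * ‖z‖ ^ 2) ≤ γ * ∑ j, ‖z j * cf W j‖ ^ 2 :=
      mul_le_mul_of_nonneg_left h2 hγ0.le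
    have h6 : γ * ‖cf W i‖ ^ 2 * 0.09 ≤ γ * ‖cf W i‖ ^ 2 * ‖z‖ ^ 2 :=
      mul_le_mul_of_nonneg_left h4 (mul_nonneg hγ0.le (sq_nonneg _))
    rw [hE]
    linarith

/-- THE SCALE-FREE WEIGHT `Φ_i(V) := |c_i|²/Σ_j|c_j|²` of the `i`-th eigen-coordinate (`Σ_i Φ_i = 1`; `Φ_i = 0`
iff the `i`-th coordinate of `y₀` vanishes). [folklore] -/
def Φ (V : ℓ2 →L[ℂ] Cd d) (i : Fin d) : ℝ := ‖cf V i‖ ^ 2 / ∑ j, ‖cf V j‖ ^ 2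

/-- `Φ` is scale-invariant. [folklore] -/
lemma Φ_smul {r : ℂ} (hr : r ≠ 0) (V : ℓ2 →L[ℂ] Cd d) (i : Fin d) : Φ (r • V) i = Φ V i := by
  have hr2 : ‖r‖ ^ 2 ≠ 0 := pow_ne_zero 2 (norm_ne_zero_iff.2 hr)
  simp only [Φ, cf_smul, norm_mul, RCLike.norm_conj, mul_pow]
  rw [← Finset.mul_sum, mul_div_mul_left _ _ hr2]

/-- COROLLARY OF THE STATE BOUND: SOME weight is small, `0.006075·γ·Φ_i ≤ (εθ)²`. [cite: Enflo2023, v2 (16) p.6; (32) p.15] -/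
theorem phi_le (hw : ∀ i, |w i| < 1) (hg : ∀ i, ‖Diag.gv (w i)‖ ^ 2 ≤ 4 / 3) {γ : ℝ} (hγ0 : 0 < γ)
    (hγ : ∀ a : Fin d → ℂ, γ * ∑ i, ‖a i‖ ^ 2 ≤ ‖(∑ i, a i • Diag.gv (w i) : ℓ2)‖ ^ 2)
    (hWS : ∀ b, W (S b) = TDg w (W b)) (hz : IsBracket W x₀ z) (hz3 : (0.3 : ℝ) ≤ ‖z‖)
    (hxz : (0.3 : ℝ) ≤ ‖x₀ - z‖) :
    ∃ i, 0.006075 * γ * Φ W i ≤ (‖adjoint W z‖ ^ 2) ^ 2 := by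
  obtain ⟨hsum, i, hi⟩ := state_bound hw hg hγ0 hγ hWS hz hz3 hxz
  refine ⟨i, ?_⟩
  have hE0 : 0 ≤ ‖adjoint W z‖ ^ 2 := sq_nonneg _
  have hA : 0 < ∑ j, ‖cf W j‖ ^ 2 := by
    rcases (Finset.sum_nonneg (fun j _ => sq_nonneg ‖cf W j‖) :
        (0 : ℝ) ≤ ∑ j, ‖cf W j‖ ^ 2).eq_or_lt with h0 | h0
    · rw [← h0, mul_zero] at hsum; norm_num at hsum
    · exact h0
  rw [Φ, ← mul_div_assoc, div_le_iff₀ hA]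
  have h1 : 0.09 * γ * ‖cf W i‖ ^ 2 * 0.0675 ≤
      ‖adjoint W z‖ ^ 2 * (‖adjoint W z‖ ^ 2 * ∑ j, ‖cf W j‖ ^ 2) := mul_le_mul hi hsum (by norm_num) hE0
  nlinarith [h1]

end statebound

/-! ### F. One admissible step: every weight `Φ_i` drops at most by `(1 + 16ντ)²`, no coordinate dies -/

section commstep

variable {w : Fin d → ℝ} {τ : ℝ} {V : ℓ2 →L[ℂ] Cd d} {N : ℓ2 →L[ℂ] ℓ2}

/-- **One admissible step.**  For `N ∈ {S}'` with `‖N‖ ≤ ν ≤ ½` and weights `|w_i| ≤ τ ≤ ½`: all coefficients of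
`V(1 + N)` stay non-zero and `Φ_i(V) ≤ (1 + 16ντ)²·Φ_i(V(1 + N))` for EVERY `i` — the eigenvalues `n_{w_i}` of
`N†` differ pairwise by `≤ 2‖N‖·‖g_{w_i} − g_{w_j}‖ ≤ 8ντ`. [cite: Enflo2023, v2 (35)–(38) p.16–17; (45) p.19] -/
theorem phi_step (hτ : τ ≤ 1 / 2) (hwτ : ∀ i, |w i| ≤ τ) (hVS : ∀ b, V (S b) = TDg w (V b))
    (hN : N ∘L S = S ∘L N) {ν : ℝ} (hNν : ‖N‖ ≤ ν) (hν : ν ≤ 1 / 2) (hc : ∀ i, cf V i ≠ 0) :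
    (∀ i, cf (V ∘L (1 + N)) i ≠ 0) ∧ ∀ i, Φ V i ≤ (1 + 16 * ν * τ) ^ 2 * Φ (V ∘L (1 + N)) i := by
  have hwh : ∀ i, |w i| ≤ 1 / 2 := fun i => (hwτ i).trans hτ
  have hw : ∀ i, |w i| < 1 := fun i => by linarith [hwh i]
  have hν0 : 0 ≤ ν := (norm_nonneg N).trans hNν
  have hτ0 : ∀ i, 0 ≤ τ := fun i => (abs_nonneg _).trans (hwτ i)
  have hn : ∀ i, ‖Diag.ev N (w i)‖ ≤ ν := fun i => (Diag.norm_ev_le hN (hw i)).trans hNν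
  have hd : ∀ i j, ‖Diag.ev N (w i) - Diag.ev N (w j)‖ ≤ 8 * ν * τ := by
    intro i j
    refine (Diag.norm_ev_sub_le hN (hw i) (hw j)).trans ?_
    have hg : ‖Diag.gv (w i) - Diag.gv (w j)‖ ≤ 4 * τ := by
      refine (norm_gv_sub_le (hwh i) (hwh j)).trans ?_
      have : |w i - w j| ≤ 2 * τ := by
        have := abs_sub (w i) (w j)
        linarith [hwτ i, hwτ j]
      linarith
    calc 2 * ‖N‖ * ‖Diag.gv (w i) - Diag.gv (w j)‖ ≤ 2 * ν * (4 * τ) :=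
          mul_le_mul (by linarith) hg (norm_nonneg _) (by positivity)
      _ = 8 * ν * τ := by ring
  have hq : ∀ i, 1 + Diag.ev N (w i) ≠ 0 := by
    intro i h0
    have : ‖Diag.ev N (w i)‖ = 1 := by
      rw [show Diag.ev N (w i) = -1 from (neg_eq_of_add_eq_zero_right h0).symm, norm_neg, norm_one]
    linarith [hn i]
  have hcf : ∀ i, cf (V ∘L (1 + N)) i = cf V i * (1 + Diag.ev N (w i)) := cf_comp hw hVS N
  refine ⟨fun i => by rw [hcf]; exact mul_ne_zero (hc i) (hq i), fun i => ?_⟩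
  -- the ratio of the multipliers
  have hrat : ∀ j, ‖1 + Diag.ev N (w j)‖ ^ 2 ≤ (1 + 2 * (8 * ν * τ)) ^ 2 * ‖1 + Diag.ev N (w i)‖ ^ 2 :=
    fun j => Diag.mult_ratio hν (hn i) (hd i j)
  set ρ : ℝ := (1 + 16 * ν * τ) ^ 2 with hρ
  set m : Fin d → ℝ := fun j => ‖cf V j‖ ^ 2 with hm
  set q : Fin d → ℝ := fun j => ‖1 + Diag.ev N (w j)‖ ^ 2 with hqd
  have hm0 : ∀ j, 0 < m j := fun j => by simp only [hm]; exact pow_pos (norm_pos_iff.2 (hc j)) 2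
  have hq0 : ∀ j, 0 < q j := fun j => by simp only [hqd]; exact pow_pos (norm_pos_iff.2 (hq j)) 2
  have hA : 0 < ∑ j, m j := by
    have : (Finset.univ : Finset (Fin d)).Nonempty := ⟨i, Finset.mem_univ i⟩
    exact Finset.sum_pos (fun j _ => hm0 j) this
  have hB : 0 < ∑ j, m j * q j := by
    have : (Finset.univ : Finset (Fin d)).Nonempty := ⟨i, Finset.mem_univ i⟩
    exact Finset.sum_pos (fun j _ => mul_pos (hm0 j) (hq0 j)) this
  have hΦ : Φ V i = m i / ∑ j, m j := rfl
  have hΦ' : Φ (V ∘L (1 + N)) i = m i * q i / ∑ j, m j * q j := by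
    simp only [Φ, hcf, norm_mul, mul_pow]
    rfl
  have hBle : ∑ j, m j * q j ≤ ρ * q i * ∑ j, m j := by
    rw [Finset.mul_sum]
    refine Finset.sum_le_sum (fun j _ => ?_)
    have h1 : q j ≤ ρ * q i := by
      have := hrat j
      rw [hρ, show (16 : ℝ) * ν * τ = 2 * (8 * ν * τ) by ring]
      exact this
    have := mul_le_mul_of_nonneg_left h1 (hm0 j).le
    linarith
  rw [hΦ, hΦ', div_le_iff₀ hA]
  rw [show ρ * (m i * q i / ∑ j, m j * q j) * ∑ j, m j = (ρ * q i * ∑ j, m j) * m i / ∑ j, m j * q j by ring,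
    le_div_iff₀ hB]
  have := mul_le_mul_of_nonneg_left hBle (hm0 i).le
  linarith

end commstep

/-! ### G. The run: `IndepRunD` fails from every start with all eigen-coordinates non-zero -/

section run

variable {w : Fin d → ℝ} {τ : ℝ} {x₀ : Cd d}

/-- every state of the model is an intertwiner `V S = T_w V`. [cite: Enflo2023, v2 (31) p.15] -/
lemma state_intertwine (s : State (TDg w) x₀ S) (b : ℓ2) : s.V (S b) = TDg w (s.V b) := s.hVS b

/-- … and so is its normalised operator `Wn s`. [cite: Enflo2023, v2 (5)–(6) p.3] -/
lemma Wn_intertwine (s : State (TDg w) x₀ S) (b : ℓ2) : Wn s (S b) = TDg w (Wn s b) := by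
  rw [Wn, smul_apply, smul_apply, state_intertwine, map_smul]

/-- `Wn s` is a NON-ZERO multiple of `s.V` (when `(εθ) > 0`). [cite: Enflo2023, v2 (5)–(6) p.3] -/
lemma Wn_eq_smul (hx₀ : ‖x₀‖ = 1) (s : State (TDg w) x₀ S) (he : 0 < s.etheta) :
    ∃ r : ℂ, r ≠ 0 ∧ Wn s = r • s.V := by
  refine ⟨_, ?_, rfl⟩
  have hne : s.a ≠ 0 := s.hmin.ne_zero (s.eps_lt hx₀)
  have hpos : 0 < Real.sqrt (‖s.a‖ ^ 2 / s.etheta) := Real.sqrt_pos.2 (div_pos (by positivity) he)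
  exact_mod_cast hpos.ne'

/-- **THE ORBIT RESIDUAL FAILS FOR EVERY DIAGONAL OPERATOR WITH SIMPLE SPECTRUM, IN EVERY DIMENSION, FROM EVERY START
WITH ALL EIGEN-COORDINATES NON-ZERO (quantitative form).**  `T_w = diag(w)` on `ℂ^d`, `w` injective,
`|w_i| ≤ τ ≤ σ/100`, `0 < σ ≤ 1`, `0 < β ≤ σ²/1000`; `s₀` a true MC state over the shift with the run's start margin
and `c_i(s₀) ≠ 0` for all `i` (all coordinates of `y₀ = V₀e₀` non-zero, `cf_eq`).  Then
`IndepRunD T_w x₀ S (ιS S) σ β s₀ → (εθ)₀ = 0`.  Proof: §E–§F along the orbit `exists_state_stepκ` builds from the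
self-pivots — `(εθ)_n = (1−β)ⁿ(εθ)₀`, every `Φ_i` drops per step at most by `(1+16ντ)²`, `ν = 2β/σ`, while
`phi_le` makes some `Φ_i(s_n) ≤ (εθ)_n²/(0.006075γ)`; `(1−β)(1 + 32βτ/σ) < 1` closes.
[cite: Enflo2023, v2 (34)–(35) p.16; (45)–(46) p.19; p.19–20] -/
theorem indepRunD_etheta_eq_zero (hinj : Function.Injective w) (hwτ : ∀ i, |w i| ≤ τ) (hx₀ : ‖x₀‖ = 1)
    {σ β : ℝ} (hσ : 0 < σ) (hσ1 : σ ≤ 1) (hτσ : τ ≤ σ / 100) (hβ0 : 0 < β) (hβ : β ≤ σ ^ 2 / 1000)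
    (s₀ : State (TDg w) x₀ S)
    (hstart : (0.09 : ℝ) + (22 / σ + 1) * s₀.etheta ≤ s₀.ε ^ 2 ∧
      s₀.ε ^ 2 + (22 / σ + 1) * s₀.etheta ≤ 0.49)
    (hcyc : ∀ i, cf s₀.V i ≠ 0) (h : IndepRunD (TDg w) x₀ S (ιS S) σ β s₀) : s₀.etheta = 0 := by
  obtain ⟨hιs, hι1, hιS⟩ := ιS_props (S : ℓ2 →L[ℂ] ℓ2)
  have hS : ‖(S : ℓ2 →L[ℂ] ℓ2)‖ ≤ 1 := norm_S_le
  have hτ2 : τ ≤ 1 / 2 := by linarith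
  have hwh : ∀ i, |w i| ≤ 1 / 2 := fun i => (hwτ i).trans hτ2
  have hw : ∀ i, |w i| < 1 := fun i => by linarith [hwh i]
  have hg : ∀ i, ‖Diag.gv (w i)‖ ^ 2 ≤ 4 / 3 := fun i => norm_gv_sq_le (hwh i)
  have hσ2 : σ ^ 2 ≤ σ := by nlinarith
  have hβ1 : β < 1 := by linarith
  have hν : 2 * β / σ ≤ 1 / 2 := by
    rw [div_le_iff₀ hσ]; linarith
  have hν0 : 0 ≤ 2 * β / σ := by positivity
  obtain ⟨γ, hγ0, hγ⟩ := exists_frame hw hinj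
  by_contra hne
  have he0 : 0 < s₀.etheta := lt_of_le_of_ne (s₀.etheta_nonneg hx₀ hS) (Ne.symm hne)
  -- `Fin d` is non-empty (`x₀ ≠ 0`), hence `0 ≤ τ`
  have hne' : (Finset.univ : Finset (Fin d)).Nonempty := by
    by_contra h0
    rw [Finset.not_nonempty_iff_eq_empty] at h0
    have : ‖x₀‖ ^ 2 = 0 := by rw [EuclideanSpace.norm_sq_eq, h0, Finset.sum_empty]
    rw [hx₀] at this
    norm_num at this
  obtain ⟨i₀, -⟩ := hne'
  have hτ0 : 0 ≤ τ := (abs_nonneg _).trans (hwτ i₀)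
  -- a positive floor for the weights at the start
  obtain ⟨p₀, hp₀, hp⟩ : ∃ p₀ : ℝ, 0 < p₀ ∧ ∀ i, p₀ ≤ Φ s₀.V i := by
    obtain ⟨i, -, hi⟩ := Finset.exists_min_image Finset.univ (fun i => Φ s₀.V i) ⟨i₀, Finset.mem_univ i₀⟩
    refine ⟨Φ s₀.V i, ?_, fun j => hi j (Finset.mem_univ j)⟩
    have hA : 0 < ∑ j, ‖cf s₀.V j‖ ^ 2 :=
      Finset.sum_pos (fun j _ => pow_pos (norm_pos_iff.2 (hcyc j)) 2) ⟨i₀, Finset.mem_univ i₀⟩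
    exact div_pos (pow_pos (norm_pos_iff.2 (hcyc i)) 2) hA
  set ρ : ℝ := (1 + 16 * (2 * β / σ) * τ) ^ 2 with hρ
  set K : ℝ := 22 / σ + 1 with hK
  have hK0 : 0 ≤ K := by positivity
  have iter : ∀ n : ℕ, ∃ s : State (TDg w) x₀ S, ReachD (ιS S) σ β s₀ s ∧
      s.etheta = (1 - β) ^ n * s₀.etheta ∧ (∀ i, cf s.V i ≠ 0) ∧ ∀ i, p₀ ≤ ρ ^ n * Φ s.V i := by
    intro n
    induction n with
    | zero => exact ⟨s₀, ReachD.start, by rw [pow_zero, one_mul], hcyc, fun i => by rw [pow_zero, one_mul]; exact hp i⟩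
    | succ n ih =>
      obtain ⟨s, hs, hes, hc, hΦ⟩ := ih
      have he : 0 < s.etheta := by rw [hes]; exact mul_pos (pow_pos (by linarith) _) he0
      have hRs : |s.ε ^ 2 - s₀.ε ^ 2| ≤ K * (s₀.etheta - s.etheta) := hs.radInv
      have hβe : K * β * s.etheta ≤ K * s.etheta := by
        have h1 : β * s.etheta ≤ s.etheta := mul_le_of_le_one_left he.le hβ1.le
        have h2 := mul_le_mul_of_nonneg_left h1 hK0
        linarith [h2]
      have hab := abs_le.1 hRs
      have hlo : (0.09 : ℝ) + (22 / σ + 1) * β * s.etheta ≤ s.ε ^ 2 := by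
        rw [← hK]; linarith [hab.1, hstart.1]
      have hhi : s.ε ^ 2 + (22 / σ + 1) * β * s.etheta ≤ 0.49 := by
        rw [← hK]; linarith [hab.2, hstart.2]
      obtain ⟨s', h1, -, h3, h4, p, hp', hV'⟩ := exists_state_stepκ hιs hι1 hιS hx₀ s he hσ hσ1 hβ0.le
        hβ (x₀ - s.v) (h s s hs hs (invP_self' _ s _) he) hlo hhi
      have hN : ‖ιS S p‖ ≤ 2 * β / σ := (hι1 p).trans hp'
      obtain ⟨r, hr, hW⟩ := Wn_eq_smul hx₀ s he
      have hV'' : s'.V = r • (s.V ∘L (1 + ιS S p)) := by rw [hV', hW, smul_comp]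
      obtain ⟨hc', hst⟩ := phi_step hτ2 hwτ (state_intertwine s) (hιS p) hN hν hc
      refine ⟨s', hs.step he ⟨p, hp', hV'⟩ h1 h3 h4, by rw [h1, hes, pow_succ]; ring, ?_, ?_⟩
      · intro i
        rw [hV'', cf_smul]
        exact mul_ne_zero ((map_ne_zero _).2 hr) (hc' i)
      · intro i
        rw [hV'', Φ_smul hr, pow_succ, mul_assoc]
        have hρ0 : 0 ≤ ρ ^ n := by positivity
        exact (hΦ i).trans (mul_le_mul_of_nonneg_left (hst i) hρ0)
  -- the state bound along the orbit
  have hbound : ∀ n : ℕ, 0.006075 * γ * p₀ ≤ ((1 - β) ^ 2 * ρ) ^ n * s₀.etheta ^ 2 := by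
    intro n
    obtain ⟨s, hs, hes, hc, hΦ⟩ := iter n
    have he : 0 < s.etheta := by rw [hes]; exact mul_pos (pow_pos (by linarith) _) he0
    have hbr : IsBracket (Wn s) x₀ s.v := isBracket_Wn hx₀ s he
    have hes' : ‖adjoint (Wn s) s.v‖ ^ 2 = s.etheta := by rw [etheta_eq_eth, eth_eq_of_isBracket hbr]
    obtain ⟨i, hb⟩ := phi_le hw hg hγ0 hγ (Wn_intertwine s) hbr (s.window hx₀).1 (norm_x₀_sub_v_ge hx₀ s)
    obtain ⟨r, hr, hW⟩ := Wn_eq_smul hx₀ s he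
    rw [hes', hes, hW, Φ_smul hr] at hb
    have hρn : 0 < ρ ^ n := by positivity
    have h1 : 0.006075 * γ * p₀ ≤ ρ ^ n * (0.006075 * γ * Φ s.V i) := by
      have := mul_le_mul_of_nonneg_left (hΦ i) (by positivity : (0 : ℝ) ≤ 0.006075 * γ)
      linarith
    calc 0.006075 * γ * p₀ ≤ ρ ^ n * (0.006075 * γ * Φ s.V i) := h1
      _ ≤ ρ ^ n * (((1 - β) ^ n * s₀.etheta) ^ 2) := mul_le_mul_of_nonneg_left hb hρn.le
      _ = ((1 - β) ^ 2 * ρ) ^ n * s₀.etheta ^ 2 := by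
        have e2 : ((1 - β) ^ n * s₀.etheta) ^ 2 = ((1 - β) ^ 2) ^ n * s₀.etheta ^ 2 := by
          rw [mul_pow, ← pow_mul, ← pow_mul, mul_comm n 2]
        rw [e2, mul_pow]; ring
  -- closure: `(1−β)²ρ = ((1−β)(1 + 32βτ/σ))² < 1` since `32τ/σ ≤ 0.32 < 1`
  have hq0 : 0 ≤ (1 - β) * (1 + 16 * (2 * β / σ) * τ) := by
    have : 0 ≤ 16 * (2 * β / σ) * τ := by positivity
    nlinarith
  have hq1 : (1 - β) * (1 + 16 * (2 * β / σ) * τ) < 1 := by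
    have h8 : 16 * (2 * β / σ) * τ ≤ 0.32 * β := by
      rw [show 16 * (2 * β / σ) * τ = β * (32 * τ / σ) by ring]
      have : 32 * τ / σ ≤ 0.32 := by rw [div_le_iff₀ hσ]; linarith
      nlinarith
    nlinarith
  have hr1 : (1 - β) ^ 2 * ρ < 1 := by
    have e : (1 - β) ^ 2 * ρ = ((1 - β) * (1 + 16 * (2 * β / σ) * τ)) ^ 2 := by rw [hρ]; ring
    rw [e]
    exact pow_lt_one₀ hq0 hq1 two_ne_zero
  obtain ⟨n, hn⟩ := Diag.exists_pow_mul_lt (E := s₀.etheta ^ 2) (by positivity) hr1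
    (by positivity : (0 : ℝ) < 0.006075 * γ * p₀)
  linarith [hbound n]

/-- The same for the run-level hypothesis `IndepRunκ` (which implies `IndepRunD`, `indepRunD_of_indepRunκ`).
[cite: Enflo2023, v2 (34) p.16; p.19–20] -/
theorem indepRunκ_etheta_eq_zero (hinj : Function.Injective w) (hwτ : ∀ i, |w i| ≤ τ) (hx₀ : ‖x₀‖ = 1)
    {σ β : ℝ} (hσ : 0 < σ) (hσ1 : σ ≤ 1) (hτσ : τ ≤ σ / 100) (hβ0 : 0 < β) (hβ : β ≤ σ ^ 2 / 1000)
    (s₀ : State (TDg w) x₀ S)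
    (hstart : (0.09 : ℝ) + (22 / σ + 1) * s₀.etheta ≤ s₀.ε ^ 2 ∧
      s₀.ε ^ 2 + (22 / σ + 1) * s₀.etheta ≤ 0.49)
    (hcyc : ∀ i, cf s₀.V i ≠ 0) (h : IndepRunκ (TDg w) x₀ S (ιS S) σ β s₀) : s₀.etheta = 0 :=
  indepRunD_etheta_eq_zero hinj hwτ hx₀ hσ hσ1 hτσ hβ0 hβ s₀ hstart hcyc (indepRunD_of_indepRunκ h)

/-- **Non-vacuity / consistency with the `d = 2` model.**  For `w = (τ, τ/2)` (`T_w = Diag.TD τ`, `TDg_wt`),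
`0 < τ ≤ σ/100`, `0 < σ ≤ 1`, `0 < β ≤ σ²/1000`: `Diag.exists_start_at` gives an admissible start with `(εθ)₀ > 0`
and both eigen-coordinates non-zero, so the general theorem applies and refutes `IndepRunD` there (re-proving
`Diag.not_indepRunD`). [cite: Enflo2023, v2 (34) p.16; p.19–20] -/
theorem not_indepRunD_two {τ σ β : ℝ} (hτ : 0 < τ) (hσ : 0 < σ) (hσ1 : σ ≤ 1) (hτσ : τ ≤ σ / 100)
    (hβ0 : 0 < β) (hβ : β ≤ σ ^ 2 / 1000) :
    ∃ (x₀ : Cd 2) (s₀ : State (TDg (Diag.wt τ)) x₀ S), ‖x₀‖ = 1 ∧ 0 < s₀.etheta ∧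
      ((0.09 : ℝ) + (22 / σ + 1) * s₀.etheta ≤ s₀.ε ^ 2 ∧ s₀.ε ^ 2 + (22 / σ + 1) * s₀.etheta ≤ 0.49) ∧
      (∀ i, cf s₀.V i ≠ 0) ∧ ¬ IndepRunD (TDg (Diag.wt τ)) x₀ S (ιS S) σ β s₀ := by
  have h01 : Diag.wt τ 0 ≠ Diag.wt τ 1 := by
    rw [Diag.wt_zero, Diag.wt_one]; intro h; linarith
  have hinj : Function.Injective (Diag.wt τ) := by
    intro i j hij
    have key : ∀ a b : Fin 2, Diag.wt τ a = Diag.wt τ b → a = b :=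
      Fin.forall_fin_two.2
        ⟨Fin.forall_fin_two.2 ⟨fun _ => rfl, fun h => absurd h h01⟩,
         Fin.forall_fin_two.2 ⟨fun h => absurd h.symm h01, fun _ => rfl⟩⟩
    exact key i j hij
  have hwτ : ∀ i, |Diag.wt τ i| ≤ τ :=
    Fin.forall_fin_two.2
      ⟨by rw [Diag.wt_zero, abs_of_pos hτ], by rw [Diag.wt_one, abs_of_pos (half_pos hτ)]; linarith⟩
  have H := fun (x₀ : Cd 2) (hx₀ : ‖x₀‖ = 1) (s₀ : State (TDg (Diag.wt τ)) x₀ S) =>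
    indepRunD_etheta_eq_zero (σ := σ) (β := β) hinj hwτ hx₀ hσ hσ1 hτσ hβ0 hβ s₀
  rw [TDg_wt] at H ⊢
  have hlt : τ < 1 := by linarith
  obtain ⟨s₀, hV, he, -, hstart⟩ := Diag.exists_start_at hτ hσ hσ1 hτσ
  obtain ⟨hζ, hY⟩ := Diag.ζ_pos_Y₀_pos hτ (by linarith)
  have hc0 : Diag.cf s₀.V 0 ≠ 0 := by rw [hV, Diag.cf_WD_zero]; exact_mod_cast hY.ne'
  have hc1 : Diag.cf s₀.V 1 ≠ 0 := by rw [hV, Diag.cf_WD_one]; exact_mod_cast hτ.ne'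
  have hc : ∀ i, cf s₀.V i ≠ 0 := Fin.forall_fin_two.2 ⟨hc0, hc1⟩
  exact ⟨Diag.xD, s₀, Diag.norm_xD, he, hstart, hc, fun h => he.ne' (H Diag.xD Diag.norm_xD s₀ hstart hc h)⟩

end run

end DiagN

end StepRealisation

end Literature.Analysis.OperatorTheory.Enflo2023

end
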